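import Summits.Ventures.YMGap.RobustBall.CentreProjectionWindow
import Literature.Probability.LatticeModels.GKSInequalities
import Literature.Probability.LatticeModels.ModifiedSimonInequality
import Literature.Probability.Percolation.DualContours
import HarnessLib

/-!
# RobustBall/ZTwoLayerIsing — the centre-projected `ℤ₂` layer of `SU(2)` lattice gauge theory IS an Ising model with couplings `|J| ≤ 2|β|`:
# the block-conditioned layer weight (no twist defect) as a Friedli–Velenik `ν_{Λ;K}` weight, and its two-point function as `⟨σ_b σ_t⟩_{Λ;K}`

HONEST FRAMING: venture file of the cell `pub-ymgap` (QuantumFields programme), track Y2 ROBUST-BALL / DS seat ds-4 (g9).  Finite sums on a finite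
torus; no area law here; nothing about the continuum.  For `N = 2` and NO twist defect (the linkwise centre-blind class, RBS §6(c)) the induced `ℤ₂`
theory of `CentreProjectionWindow` carries only Wilson plaquette weights; conditioned on the transverse links and the off-layer `i`-links
(`ZNFluxW.layerWeightW`) the free `i`-links interact only through the layer plaquettes, each reading its two `i`-links — an ISING PAIR INTERACTION
`J_p s_x s_{x+e_v}`, `J_p = β ψ₂(T_p) Re tr U_p ∈ [−2|β|, 2|β|]` (`layerWeightW_two_eq`); the rung two-point function is the Ising correlation in the
tree's Friedli–Velenik format (`cavg_ψ_two_eq_gksExpect`), so by Griffiths' comparison (`gksExpect_mono_of_abs_le` + a spin flip)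
`|E ψ₂(σ_b − σ_t)| ≤ ⟨σ_b σ_t⟩_{Λ; 2|β|}` (`norm_cavg_ψ_two_le_gksExpect_const`).  Refs: Mack–Petkova 1979 §2; Friedli–Velenik 2017 §3.8.1.
-/

noncomputable section

open Finset
open Literature.MathematicalPhysics.QuantumFieldTheory

namespace Summit.Ventures.YMGap.RobustBall

namespace ZTwo

open ZN ZNFluxW

variable {d L : ℕ}

/-! ### `ψ₂` is real: `±1` -/

/-- The real sign `ψ₂(a) ∈ {1, −1}`. [folklore] -/
def sgn (a : ZMod 2) : ℝ := if a = 0 then 1 else -1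

/-- `ψ₂ 1 = −1`. [folklore] -/
theorem ψ_two_one : ψ 2 1 = -1 := by
  have h2 : ψ 2 1 * ψ 2 1 = 1 := by rw [← pow_two]; exact ψ_pow_card (N := 2) 1
  rcases mul_self_eq_one_iff.1 h2 with h | h
  · exact absurd h (ψ_one_ne_one (N := 2) le_rfl)
  · exact h

/-- `sgn 0 = 1`. [folklore] -/
@[simp] theorem sgn_zero : sgn 0 = 1 := by simp [sgn]

/-- `sgn 1 = −1`. [folklore] -/
@[simp] theorem sgn_one : sgn 1 = -1 := by simp [sgn]

/-- `ψ₂(a) = sgn a` as a complex number. [folklore] -/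
theorem ψ_two_eq (a : ZMod 2) : ψ 2 a = (sgn a : ℂ) := by
  by_cases h : a = 0
  · subst h; rw [sgn_zero, ψ_zero (N := 2)]; simp
  · rw [Literature.Probability.Percolation.Contour.zmod2_eq_one_of_ne_zero h, sgn_one, ψ_two_one]; simp

/-- `sgn (a + b) = sgn a · sgn b`. [folklore] -/
theorem sgn_add (a b : ZMod 2) : sgn (a + b) = sgn a * sgn b := by
  have h := ψ_add (N := 2) a b
  rw [ψ_two_eq, ψ_two_eq, ψ_two_eq] at h
  exact_mod_cast h

/-- `sgn (a − b) = sgn a · sgn b` (in `ℤ/2`, `−b = b`). [folklore] -/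
theorem sgn_sub (a b : ZMod 2) : sgn (a - b) = sgn a * sgn b := by rw [sub_eq_add_neg, sgn_add, ZMod.neg_eq_self_mod_two]

/-- `|sgn a| = 1`. [folklore] -/
theorem abs_sgn (a : ZMod 2) : |sgn a| = 1 := by unfold sgn; split_ifs <;> simp

/-! ### The layer plaquettes and their reading of the free `i`-links -/

variable [NeZero L]

/-- The `i`-PLAQUETTES AT THE SELECTED HEIGHTS: plaquettes with a side of direction `i` and base height in `H`. [folklore] -/
def layerPlaqs (i : Fin d) (H : Finset (ZMod L)) : Finset (Plaquette d L) :=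
  Finset.univ.filter fun p => (p.2.1.1 = i ∨ p.2.1.2 = i) ∧ p.1 i ∈ H

/-- Membership in `layerPlaqs`. [folklore] -/
theorem mem_layerPlaqs {i : Fin d} {H : Finset (ZMod L)} {p : Plaquette d L} :
    p ∈ layerPlaqs i H ↔ (p.2.1.1 = i ∨ p.2.1.2 = i) ∧ p.1 i ∈ H := by
  simp [layerPlaqs]

/-- The transverse flux of a plaquette: its flux with all `i`-links set to `0`. [folklore] -/
def transFlux (i : Fin d) (kT : Transverse d L (ZMod 2) i) (p : Plaquette d L) : ZMod 2 := flux (glue i (fun _ => 0) kT) p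

/-- A layer plaquette reads exactly two `i`-links (`L ≥ 2`). [folklore] -/
theorem card_iSites_eq_two (hL : 2 ≤ L) (i : Fin d) (p : Plaquette d L) (hp : p.2.1.1 = i ∨ p.2.1.2 = i) :
    (iSites i p).card = 2 := by
  obtain ⟨z, ⟨⟨a, b⟩, hab⟩⟩ := p
  have hne : a ≠ b := (show a < b from hab).ne
  simp only at hp
  rcases hp with rfl | rfl
  · simp only [iSites, if_true]
    exact Finset.card_pair (Literature.MathematicalPhysics.QuantumFieldTheory.Balaban1983to89.StrongCouplingTorusWindow.shift_ne_self (by omega) z b).symm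
  · simp only [iSites, hne, if_false, if_true]
    exact Finset.card_pair (Literature.MathematicalPhysics.QuantumFieldTheory.Balaban1983to89.StrongCouplingTorusWindow.shift_ne_self (by omega) z a)

/-- **A layer plaquette reads its two `i`-links**: for a plaquette with a side of direction `i`,
`sgn(curl k)_p = sgn(T_p) · ∏_{y ∈ iSites i p} sgn(kI y)` (`L ≥ 2`). [folklore] -/
theorem sgn_flux_glue (hL : 2 ≤ L) (i : Fin d) (kI : Site d L → ZMod 2) (kT : Transverse d L (ZMod 2) i)
    (p : Plaquette d L) (hp : p.2.1.1 = i ∨ p.2.1.2 = i) :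
    sgn (flux (ZN.glue i kI kT) p) = sgn (transFlux i kT p) * ∏ y ∈ iSites i p, sgn (kI y) := by
  obtain ⟨z, ⟨⟨a, b⟩, hab⟩⟩ := p
  have hne : a ≠ b := (show a < b from hab).ne
  simp only at hp
  unfold transFlux flux plaqSum
  rcases hp with rfl | rfl
  · have hb : b ≠ a := hne.symm
    simp only [iSites, if_true]
    rw [Finset.prod_pair (Literature.MathematicalPhysics.QuantumFieldTheory.Balaban1983to89.StrongCouplingTorusWindow.shift_ne_self (by omega) z b).symm, glue_apply_site, glue_apply_site,
      glue_apply_of_ne _ _ (show ((z.shift a, b) : Edge d L).2 ≠ a from hb),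
      glue_apply_of_ne _ _ (show ((z, b) : Edge d L).2 ≠ a from hb), glue_apply_site, glue_apply_site,
      glue_apply_of_ne _ _ (show ((z.shift a, b) : Edge d L).2 ≠ a from hb),
      glue_apply_of_ne _ _ (show ((z, b) : Edge d L).2 ≠ a from hb)]
    simp only [sgn_sub, sgn_add, sgn_zero]
    ring
  · simp only [iSites, hne, if_false, if_true]
    rw [Finset.prod_pair (Literature.MathematicalPhysics.QuantumFieldTheory.Balaban1983to89.StrongCouplingTorusWindow.shift_ne_self (by omega) z a), glue_apply_site, glue_apply_site,
      glue_apply_of_ne _ _ (show ((z, a) : Edge d L).2 ≠ b from hne),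
      glue_apply_of_ne _ _ (show ((z.shift b, a) : Edge d L).2 ≠ b from hne), glue_apply_site, glue_apply_site,
      glue_apply_of_ne _ _ (show ((z, a) : Edge d L).2 ≠ b from hne),
      glue_apply_of_ne _ _ (show ((z.shift b, a) : Edge d L).2 ≠ b from hne)]
    simp only [sgn_sub, sgn_add, sgn_zero]
    ring

omit [NeZero L] in
/-- A plaquette that reads an `i`-link has a side of direction `i`. [folklore] -/
theorem dir_of_mem_iSites (i : Fin d) (p : Plaquette d L) {y : Site d L} (hy : y ∈ iSites i p) :
    p.2.1.1 = i ∨ p.2.1.2 = i := by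
  unfold iSites at hy
  split_ifs at hy with h1 h2
  · exact Or.inl h1
  · exact Or.inr h2
  · simp at hy

/-! ### The Ising couplings of the layer and the factorisation of the block-conditioned weight -/

/-- **The Ising coupling of a layer plaquette** in the background `(U, kT)`: `J_p = β · sgn(T_p) · Re tr U_p`. [folklore] -/
def coupling (β : ℝ) (U : GaugeConfig d L (SUN 2)) (i : Fin d) (kT : Transverse d L (ZMod 2) i) (p : Plaquette d L) : ℝ :=
  β * sgn (transFlux i kT p) * ((plaquetteHolonomy U p.1 p.2.1.1 p.2.1.2 : SUN 2) : Matrix (Fin 2) (Fin 2) ℂ).trace.re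

omit [NeZero L] in
/-- `|J_p| ≤ 2|β|`. [folklore] -/
theorem abs_coupling_le (β : ℝ) (U : GaugeConfig d L (SUN 2)) (i : Fin d) (kT : Transverse d L (ZMod 2) i) (p : Plaquette d L) :
    |coupling β U i kT p| ≤ 2 * |β| := by
  unfold coupling
  rw [abs_mul, abs_mul, abs_sgn, mul_one]
  have h : |((plaquetteHolonomy U p.1 p.2.1.1 p.2.1.2 : SUN 2) : Matrix (Fin 2) (Fin 2) ℂ).trace.re| ≤ 2 :=
    (Complex.abs_re_le_norm _).trans (by simpa using norm_trace_le (plaquetteHolonomy U p.1 p.2.1.1 p.2.1.2 : SUN 2))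
  calc |β| * |((plaquetteHolonomy U p.1 p.2.1.1 p.2.1.2 : SUN 2) : Matrix (Fin 2) (Fin 2) ℂ).trace.re| ≤ |β| * 2 :=
        mul_le_mul_of_nonneg_left h (abs_nonneg β)
    _ = 2 * |β| := by ring

/-- The spin configuration (`±1`-valued) of a `ℤ/2` link configuration. [folklore] -/
def spinOf (σ : Site d L → ZMod 2) : Literature.Probability.LatticeModels.SpinConfig (Site d L) :=
  fun y => if σ y = 0 then 1 else -1

omit [NeZero L] in
/-- `spinAt y (spinOf σ) = sgn (σ y)`. [folklore] -/
@[simp] theorem spinAt_spinOf (σ : Site d L → ZMod 2) (y : Site d L) :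
    Literature.Probability.LatticeModels.spinAt y (spinOf σ) = sgn (σ y) := by
  unfold Literature.Probability.LatticeModels.spinAt spinOf sgn
  split_ifs <;> simp

/-- `spinOf` is a bijection `(Site → ℤ/2) ≃ SpinConfig Site`. [folklore] -/
def spinEquiv : (Site d L → ZMod 2) ≃ Literature.Probability.LatticeModels.SpinConfig (Site d L) where
  toFun := spinOf
  invFun ω := fun y => if ω y = 1 then 0 else 1
  left_inv σ := by
    funext y
    by_cases h : σ y = 0
    · simp [spinOf, h]
    · simp [spinOf, Literature.Probability.Percolation.Contour.zmod2_eq_one_of_ne_zero h]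
  right_inv ω := by
    funext y
    rcases Int.units_eq_one_or (ω y) with h | h <;> simp [spinOf, h]

/-- The `σ`-independent part of the exponent: plaquettes off the selected layers, read through the frozen links. [folklore] -/
def restExp (β : ℝ) (U : GaugeConfig d L (SUN 2)) (i : Fin d) (H : Finset (ZMod L)) (kT : Transverse d L (ZMod 2) i)
    (κ : Site d L → ZMod 2) : ℝ :=
  ∑ p ∈ Finset.univ.filter (fun p => p ∉ layerPlaqs i H),
    β * (sgn (flux (ZN.glue i κ kT) p) * ((plaquetteHolonomy U p.1 p.2.1.1 p.2.1.2 : SUN 2) : Matrix (Fin 2) (Fin 2) ℂ).trace.re)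

omit [NeZero L] in
/-- The Wilson plaquette activity at `N = 2` is real: `(ψ₂(φ) tr U_p).re = sgn φ · Re tr U_p`. [folklore] -/
theorem gS_inl_two (β : ℝ) (gD : Fin 0 → (Plaquette d L → ZMod 2) → GaugeConfig d L (SUN 2) → ℝ) (U : GaugeConfig d L (SUN 2))
    (p : Plaquette d L) (φ : Plaquette d L → ZMod 2) :
    gS β gD U (Sum.inl p) φ = β * (sgn (φ p) * ((plaquetteHolonomy U p.1 p.2.1.1 p.2.1.2 : SUN 2) : Matrix (Fin 2) (Fin 2) ℂ).trace.re) := by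
  simp only [gS, Sum.elim_inl, ψ_two_eq, Complex.re_ofReal_mul]

/-- **THE BLOCK-CONDITIONED `ℤ₂` LAYER WEIGHT IS AN ISING WEIGHT** (`L ≥ 2`, no twist defect): for free `i`-links `σ`,
`w(σ) = e^{rest} · exp(∑_{p ∈ layerPlaqs} J_p ∏_{y ∈ iSites i p} sgn σ_y)` = `e^{rest} · ν`-weight of Friedli–Velenik with index set
`layerPlaqs i H`, couplings `J`, supports `iSites i`. [folklore] -/
theorem layerWeightW_two_eq (hL : 2 ≤ L) (β : ℝ) (gD : Fin 0 → (Plaquette d L → ZMod 2) → GaugeConfig d L (SUN 2) → ℝ)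
    (U : GaugeConfig d L (SUN 2)) (i : Fin d) (H : Finset (ZMod L)) (kT : Transverse d L (ZMod 2) i) (κ σ : Site d L → ZMod 2) :
    layerWeightW (gS β gD U) i H kT κ σ =
      Real.exp (restExp β U i H kT κ) *
        Literature.Probability.LatticeModels.gksWeight (layerPlaqs i H) (coupling β U i kT) (iSites i) (spinOf σ) := by
  classical
  unfold layerWeightW znWD Literature.Probability.LatticeModels.gksWeight Literature.Probability.LatticeModels.gksHamiltonian
  rw [← Real.exp_add]
  congr 1
  rw [Fintype.sum_sum_type, Finset.univ_eq_empty (α := Fin 0), Finset.sum_empty, add_zero]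
  simp only [gS_inl_two]
  rw [← Finset.sum_filter_add_sum_filter_not Finset.univ (fun p => p ∈ layerPlaqs i H), add_comm]
  congr 1
  · -- off the selected layers the free links are not read
    refine Finset.sum_congr rfl fun p hp => ?_
    have hp' : p ∉ layerPlaqs i H := (Finset.mem_filter.1 hp).2
    have hflux : flux (ZN.glue i ((block i H).piecewise σ κ) kT) p = flux (ZN.glue i κ kT) p :=
      plaqSum_glue_congr i kT p fun y hy => by
        have hdir := dir_of_mem_iSites i p hy
        have hyi : y i = p.1 i := apply_eq_of_mem_iSites i p hy
        have hyB : y ∉ block i H := fun hyB => hp' (mem_layerPlaqs.2 ⟨hdir, hyi ▸ mem_block.1 hyB⟩)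
        rw [Finset.piecewise_eq_of_notMem _ _ _ hyB]
    rw [hflux]
  · -- on the selected layers each plaquette reads its two free links
    rw [Finset.filter_mem_eq_inter, Finset.univ_inter]
    refine Finset.sum_congr rfl fun p hp => ?_
    have hdir := (mem_layerPlaqs.1 hp).1
    have hflux : flux (ZN.glue i ((block i H).piecewise σ κ) kT) p = flux (ZN.glue i σ kT) p :=
      plaqSum_glue_congr i kT p fun y hy => by
        have hyi : y i = p.1 i := apply_eq_of_mem_iSites i p hy
        have hyB : y ∈ block i H := mem_block.2 (hyi ▸ (mem_layerPlaqs.1 hp).2)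
        rw [Finset.piecewise_eq_of_mem _ _ _ hyB]
    rw [hflux, sgn_flux_glue hL i σ kT p hdir, coupling, Literature.Probability.LatticeModels.spinProduct]
    simp only [spinAt_spinOf]
    ring

/-- **THE RUNG TWO-POINT FUNCTION IS AN ISING CORRELATION**: `E ψ₂(σ_b − σ_t) = ⟨σ_b σ_t⟩_{Λ;J}` (Friedli–Velenik format, index set
`layerPlaqs i H`, couplings `J`, supports `iSites i`; `L ≥ 2`). [folklore] -/
theorem cavg_ψ_two_eq_gksExpect (hL : 2 ≤ L) (β : ℝ) (gD : Fin 0 → (Plaquette d L → ZMod 2) → GaugeConfig d L (SUN 2) → ℝ)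
    (U : GaugeConfig d L (SUN 2)) (i : Fin d) (H : Finset (ZMod L)) (kT : Transverse d L (ZMod 2) i) (κ : Site d L → ZMod 2)
    (b t : Site d L) :
    FiniteGibbs.cavg (layerWeightW (gS β gD U) i H kT κ) (fun σ => ψ 2 (σ b - σ t)) =
      (Literature.Probability.LatticeModels.gksExpect (layerPlaqs i H) (coupling β U i kT) (iSites i)
        (Literature.Probability.LatticeModels.spinPair b t) : ℂ) := by
  classical
  set K := coupling β U i kT with hK
  set C : ℝ := Real.exp (restExp β U i H kT κ) with hC
  have hC0 : C ≠ 0 := (Real.exp_pos _).ne'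
  have hw : ∀ σ, layerWeightW (gS β gD U) i H kT κ σ =
      C * Literature.Probability.LatticeModels.gksWeight (layerPlaqs i H) K (iSites i) (spinEquiv σ) :=
    fun σ => layerWeightW_two_eq hL β gD U i H kT κ σ
  have hobs : ∀ σ : Site d L → ZMod 2, ψ 2 (σ b - σ t) =
      (Literature.Probability.LatticeModels.spinPair b t (spinEquiv σ) : ℂ) := by
    intro σ
    rw [ψ_two_eq, sgn_sub, Literature.Probability.LatticeModels.spinPair]
    simp [spinEquiv]
  unfold FiniteGibbs.cavg FiniteGibbs.mass Literature.Probability.LatticeModels.gksExpect Literature.Probability.LatticeModels.gksSum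
  simp only [hw, hobs]
  -- numerator and mass through the bijection `spinEquiv`
  have hnum : ∑ σ : Site d L → ZMod 2,
      ((C * Literature.Probability.LatticeModels.gksWeight (layerPlaqs i H) K (iSites i) (spinEquiv σ) : ℝ) : ℂ) *
        (Literature.Probability.LatticeModels.spinPair b t (spinEquiv σ) : ℂ) =
      ((C * ∑ ω, Literature.Probability.LatticeModels.spinPair b t ω *
        Literature.Probability.LatticeModels.gksWeight (layerPlaqs i H) K (iSites i) ω : ℝ) : ℂ) := by
    push_cast
    rw [Finset.mul_sum]
    exact Fintype.sum_equiv spinEquiv _ _ fun σ => by ring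
  have hden : ∑ σ : Site d L → ZMod 2, C * Literature.Probability.LatticeModels.gksWeight (layerPlaqs i H) K (iSites i) (spinEquiv σ) =
      C * ∑ ω, (fun _ => (1 : ℝ)) ω * Literature.Probability.LatticeModels.gksWeight (layerPlaqs i H) K (iSites i) ω := by
    rw [Finset.mul_sum]
    exact Fintype.sum_equiv spinEquiv _ _ fun σ => by ring
  rw [hnum, hden]
  push_cast
  rw [mul_div_mul_left _ _ (by exact_mod_cast hC0)]

/-! ### Griffiths' comparison with the ferromagnet at the uniform coupling `2|β|` -/

section Griffiths

variable {Λ ι : Type*} [Fintype Λ] [DecidableEq Λ] [DecidableEq ι]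

/-- Flipping the spin at `b`. [folklore] -/
def flipAt (b : Λ) (ω : Literature.Probability.LatticeModels.SpinConfig Λ) : Literature.Probability.LatticeModels.SpinConfig Λ :=
  Function.update ω b (-ω b)

omit [Fintype Λ] [DecidableEq ι] in
/-- `flipAt b` is an involution. [folklore] -/
theorem flipAt_flipAt (b : Λ) (ω : Literature.Probability.LatticeModels.SpinConfig Λ) : flipAt b (flipAt b ω) = ω := by
  funext y
  unfold flipAt
  by_cases hy : y = b
  · subst hy; simp
  · simp [Function.update_of_ne hy]

omit [Fintype Λ] [DecidableEq ι] in
/-- A spin product picks up the sign `(−1)^{[b ∈ A]}` under the flip at `b`. [folklore] -/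
theorem spinProduct_flipAt (b : Λ) (A : Finset Λ) (ω : Literature.Probability.LatticeModels.SpinConfig Λ) :
    Literature.Probability.LatticeModels.spinProduct A (flipAt b ω) =
      (if b ∈ A then -1 else 1) * Literature.Probability.LatticeModels.spinProduct A ω := by
  unfold Literature.Probability.LatticeModels.spinProduct
  have hterm : ∀ y, Literature.Probability.LatticeModels.spinAt y (flipAt b ω) =
      (if y = b then -1 else 1) * Literature.Probability.LatticeModels.spinAt y ω := by
    intro y
    unfold Literature.Probability.LatticeModels.spinAt flipAt
    by_cases hy : y = b
    · subst hy; simp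
    · simp [hy]
  simp_rw [hterm]
  rw [Finset.prod_mul_distrib, Finset.prod_ite_eq' A b]

/-- **`|⟨σ_A⟩_{K'}| ≤ ⟨σ_A⟩_K` whenever `|K'ᵢ| ≤ Kᵢ`** (Griffiths' comparison plus the spin flip at a site of `A`). [folklore] -/
theorem abs_gksExpect_spinProduct_le (s : Finset ι) {K K' : ι → ℝ} (C : ι → Finset Λ) (hK : ∀ j ∈ s, |K' j| ≤ K j)
    (A : Finset Λ) :
    |Literature.Probability.LatticeModels.gksExpect s K' C (Literature.Probability.LatticeModels.spinProduct A)| ≤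
      Literature.Probability.LatticeModels.gksExpect s K C (Literature.Probability.LatticeModels.spinProduct A) := by
  classical
  refine abs_le.2 ⟨?_, Literature.Probability.LatticeModels.gksExpect_mono_of_abs_le s C hK A⟩
  -- lower bound: flip a spin of `A` (if `A = ∅` the correlation is `1 ≥ -1 ≥ …` trivially handled by the same flip with no sign)
  by_cases hA : A.Nonempty
  · obtain ⟨b, hb⟩ := hA
    -- flipped couplings
    set K'' : ι → ℝ := fun j => (if b ∈ C j then -1 else 1) * K' j with hK''
    have hK''abs : ∀ j ∈ s, |K'' j| ≤ K j := fun j hj => by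
      rw [hK'', abs_mul]
      have : |(if b ∈ C j then (-1 : ℝ) else 1)| = 1 := by split_ifs <;> simp
      rw [this, one_mul]; exact hK j hj
    have hw : ∀ ω, Literature.Probability.LatticeModels.gksWeight s K' C (flipAt b ω) =
        Literature.Probability.LatticeModels.gksWeight s K'' C ω := by
      intro ω
      unfold Literature.Probability.LatticeModels.gksWeight Literature.Probability.LatticeModels.gksHamiltonian
      congr 1
      refine Finset.sum_congr rfl fun j _ => ?_
      rw [spinProduct_flipAt, hK'']; ring
    have hw' : ∀ ω, Literature.Probability.LatticeModels.gksWeight s K'' C (flipAt b ω) =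
        Literature.Probability.LatticeModels.gksWeight s K' C ω := fun ω => by rw [← hw, flipAt_flipAt]
    have hflipSum : ∀ f : Literature.Probability.LatticeModels.SpinConfig Λ → ℝ,
        Literature.Probability.LatticeModels.gksSum s K' C f =
          Literature.Probability.LatticeModels.gksSum s K'' C (fun ω => f (flipAt b ω)) := by
      intro f
      unfold Literature.Probability.LatticeModels.gksSum
      exact Fintype.sum_equiv ⟨flipAt b, flipAt b, flipAt_flipAt b, flipAt_flipAt b⟩ _ _ fun ω => by
        show f ω * Literature.Probability.LatticeModels.gksWeight s K' C ω =
          f (flipAt b (flipAt b ω)) * Literature.Probability.LatticeModels.gksWeight s K'' C (flipAt b ω)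
        rw [flipAt_flipAt, hw']
    have hnum : Literature.Probability.LatticeModels.gksSum s K' C (Literature.Probability.LatticeModels.spinProduct A) =
        -Literature.Probability.LatticeModels.gksSum s K'' C (Literature.Probability.LatticeModels.spinProduct A) := by
      rw [hflipSum]
      unfold Literature.Probability.LatticeModels.gksSum
      rw [← Finset.sum_neg_distrib]
      refine Finset.sum_congr rfl fun ω _ => ?_
      show Literature.Probability.LatticeModels.spinProduct A (flipAt b ω) * _ = _
      rw [spinProduct_flipAt, if_pos hb]; ring
    have hden : Literature.Probability.LatticeModels.gksSum s K' C (fun _ => 1) =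
        Literature.Probability.LatticeModels.gksSum s K'' C (fun _ => 1) := by
      rw [hflipSum]
    have h2 := Literature.Probability.LatticeModels.gksExpect_mono_of_abs_le s C hK''abs A
    unfold Literature.Probability.LatticeModels.gksExpect at h2 ⊢
    rw [hnum, hden, neg_div]
    linarith
  · rw [Finset.not_nonempty_iff_eq_empty.1 hA]
    have h1 : ∀ K₀ : ι → ℝ, Literature.Probability.LatticeModels.gksExpect s K₀ C (Literature.Probability.LatticeModels.spinProduct ∅) = 1 := by
      intro K₀
      have he : Literature.Probability.LatticeModels.spinProduct (∅ : Finset Λ) = fun _ => (1 : ℝ) := by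
        funext ω; simp [Literature.Probability.LatticeModels.spinProduct]
      unfold Literature.Probability.LatticeModels.gksExpect
      rw [he]
      exact div_self (Literature.Probability.LatticeModels.gksSum_one_pos s K₀ C).ne'
    rw [h1, h1]; norm_num

end Griffiths

/-- **`|E ψ₂(σ_b − σ_t)| ≤ ⟨σ_b σ_t⟩_{Λ; 2|β|}`**: the rung two-point function of the `ℤ₂` layer is dominated by the FERROMAGNETIC Ising
correlation at the uniform coupling `2|β|` on the same plaquette-indexed pair structure (`L ≥ 2`). [folklore] -/
theorem norm_cavg_ψ_two_le_gksExpect_const (hL : 2 ≤ L) (β : ℝ) (gD : Fin 0 → (Plaquette d L → ZMod 2) → GaugeConfig d L (SUN 2) → ℝ)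
    (U : GaugeConfig d L (SUN 2)) (i : Fin d) (H : Finset (ZMod L)) (kT : Transverse d L (ZMod 2) i) (κ : Site d L → ZMod 2)
    (b t : Site d L) :
    ‖FiniteGibbs.cavg (layerWeightW (gS β gD U) i H kT κ) (fun σ => ψ 2 (σ b - σ t))‖ ≤
      Literature.Probability.LatticeModels.gksExpect (layerPlaqs i H) (fun _ => 2 * |β|) (iSites i)
        (Literature.Probability.LatticeModels.spinPair b t) := by
  classical
  rw [cavg_ψ_two_eq_gksExpect hL, Complex.norm_real, Real.norm_eq_abs,
    Literature.Probability.LatticeModels.spinPair_eq_spinProduct_symmDiff]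
  exact abs_gksExpect_spinProduct_le _ _ (fun p _ => abs_coupling_le β U i kT p) _

end ZTwo

end Summit.Ventures.YMGap.RobustBall

end
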